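import Literature.AlgebraicGeometry.Frobenioids.Thm42SubII
import Literature.AlgebraicGeometry.Frobenioids.DivFrobeniusTrivialTransport
import Literature.AlgebraicGeometry.Frobenioids.GroupLikeObjectsWLOG
import Literature.AlgebraicGeometry.Frobenioids.EquivalenceFrobeniusEndomorphisms
import HarnessLib

/-!
# Frobenioids I, Theorem 4.2 (i), row T42-L02 (`PreservesDivFrobTrivial`): the three clauses,
# from the Div-identity clause (row L11) resp. over FSM-type bases

Mochizuki, *The geometry of Frobenioids I: the general theory*, Kyushu J. Math. **62** (2008)
293–400, Thm. 4.2 (i), kurims text p. 78 ll. 36–38 [cite: MochizukiFrdI2008, Thm. 4.2 (i) p.78]: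
"Now by Proposition 1.14, (v) [cf. also Theorem 3.4, (ii)], it follows immediately that `Ψ` preserves
non-group-like Div-Frobenius-trivial objects, as well as Div-identity prime-Frobenius endomorphisms
of such objects. Since `Ψ` preserves morphisms of Frobenius type and pull-back morphisms [Thm. 3.4
(iii)], `Ψ` preserves universally Div-Frobenius-trivial objects."

PROOF-ONLY file (seat abc-iut-w4-d090, filer-of-record of the Thm. 4.2 closeout, L1-lead R81 (4)) on
the slot `FrdI.T42.PreservesDivFrobTrivial` of `Thm42Sub.lean` (seat abc-iut-L1-t14). OBSERVATION
(recorded for the sub-DAG's one writer): the slot quantifies over `FrdI.T42.Setting F₁ F₂ Ψ` only, while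
the printed argument (Prop. 1.14 (v)) uses that the bases are of FSMFF-type and the divisor monoids are
non-dilating (clauses (d), (e) of "standard type", hypotheses of Thm. 4.2 not recorded in `Setting`);
no closer of the slot AS TYPED is claimed here. What is proved:

* `FrdI.T42.Setting.isGroupLikeObj_map` — in the setting, `Ψ` carries group-like objects to group-like
  objects (a non-trivial `x ∈ Φ₂(Ψ A)` is the zero divisor of a step out of `Ψ A`, whose image under
  `Ψ⁻¹` would be a step out of the group-like `Ψ⁻¹Ψ A ≅ A` — impossible in a Frobenioid of isotropic
  type);
* `FrdI.T42.preservesDivFrobTrivial_of_isDivIdentity_map` — the three clauses (a) Div-identity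
  prime-Frobenius endomorphisms, (b) Div-Frobenius-trivial objects, (c) universally Div-Frobenius-trivial
  objects (non-group-like) of the slot, GIVEN that `Ψ` preserves the Div-identity endomorphisms of
  non-group-like objects (the conclusion of row L11 `PreservesDivIdentity`; (b), (c) by seat
  abc-iut-L1-t14's `isDivFrobeniusTrivial_map` / `isUniversallyDivFrobeniusTrivial_map`, the Div-identity
  hypothesis at group-like domains of pull-back morphisms being automatic);
* `FrdI.T42.preservesDivFrobTrivial_of_preservesDivIdentity` — the same with row L11 consumed BY NAME
  (`PreservesDivIdentity`, non-dilating `Φ_i`, primary pre-steps preserved both ways);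
* `FrdI.T42.isDivIdentity_isPrimeFrobenius_map_of_isOfFSMType` — clause (a) unconditionally over
  bases of FSM-type with `Φ₂` non-dilating (the cell's Prop. 1.14 (v) route, seat abc-iut-L1-t13's
  `FrdI.isDivIdentity_isPrimeFrobenius_map`).

No new definitions; no statement of the paper is strengthened.
-/

namespace Literature.AlgebraicGeometry.Frobenioids

namespace FrdI.T42

open CategoryTheory Opposite

universe w v v' u u'

variable {D₁ : Type u} [Category.{v} D₁] {Φ₁ : D₁ᵒᵖ ⥤ CommMonCat.{w}} {C₁ : Type u'} [Category.{v'} C₁]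
  {D₂ : Type u} [Category.{v} D₂] {Φ₂ : D₂ᵒᵖ ⥤ CommMonCat.{w}} {C₂ : Type u'} [Category.{v'} C₂]
  {F₁ : C₁ ⥤ ElemFrobenioid Φ₁} {F₂ : C₂ ⥤ ElemFrobenioid Φ₂} {Ψ : C₁ ≌ C₂}

/-! ### `Ψ` preserves group-like objects (Thm. 3.4 (ii), inside the setting) -/

set_option backward.isDefEq.respectTransparency false in
/-- In the setting of the proof of Thm. 4.2 (Frobenioids of isotropic type, `Ψ⁻¹` carrying steps to
steps), `Ψ` carries group-like objects to group-like objects ("`Ψ` preserves non-group-like objects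
[cf. Theorem 3.4, (ii)]", p. 78 l. 33, applied to `Ψ⁻¹`): a non-trivial element of `Φ₂(Ψ A)` is the zero
divisor of a step out of `Ψ A` (Def. 1.3 (iii)(d)), whose image under `Ψ⁻¹` is a step out of the
group-like object `Ψ⁻¹Ψ A ≅ A` — but pre-steps out of group-like objects of a Frobenioid of isotropic type
are isomorphisms. [cite: MochizukiFrdI2008, Thm. 4.2 (i) p.78] -/
theorem Setting.isGroupLikeObj_map (S : Setting F₁ F₂ Ψ) {A : C₁} (hA : PreFrobenioid.IsGroupLikeObj F₁ A) :
    PreFrobenioid.IsGroupLikeObj F₂ (Ψ.functor.obj A) := by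
  by_contra h
  obtain ⟨x, hx⟩ := not_forall.mp h
  obtain ⟨B₂, α₂, hα₂, -⟩ := PreFrobenioid.exists_step_of_ne_one F₂ S.isFrobenioid₂ hx
  have hA' : PreFrobenioid.IsGroupLikeObj F₁ (Ψ.inverse.obj (Ψ.functor.obj A)) :=
    PreFrobenioid.isGroupLikeObj_of_isBaseIso (Ψ.unitInv.app A)
      (PreFrobenioid.isPreStep_of_isIso F₁ _).2 hA
  exact (PreFrobenioid.not_isGroupLikeObj_of_isStep S.isotropic₁ (S.step_inv α₂ hα₂)).1 hA'

/-! ### The three clauses of `PreservesDivFrobTrivial` from the Div-identity clause -/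

/-- **Row T42-L02 from row L11's conclusion**: in the setting of the proof of Thm. 4.2, if `Ψ` carries
Div-identity endomorphisms of non-group-like objects to Div-identity endomorphisms, then (a) `Ψ` carries
Div-identity prime-Frobenius endomorphisms of non-group-like objects to Div-identity endomorphisms,
(b) non-group-like Div-Frobenius-trivial objects to Div-Frobenius-trivial objects ("since `Ψ` preserves
morphisms of Frobenius type" and Frobenius degrees), and (c) non-group-like universally
Div-Frobenius-trivial objects to universally Div-Frobenius-trivial objects ("and pull-back morphisms") —
the Div-identity hypothesis at a group-like domain of a pull-back morphism being automatic, `Ψ` preserving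
group-like objects (`Setting.isGroupLikeObj_map`). [cite: MochizukiFrdI2008, Thm. 4.2 (i) p.78] -/
theorem preservesDivFrobTrivial_of_isDivIdentity_map (S : Setting F₁ F₂ Ψ)
    (hdivid : ∀ (A : C₁), ¬ PreFrobenioid.IsGroupLikeObj F₁ A → ∀ α : A ⟶ A,
      PreFrobenioid.IsDivIdentity F₁ α → PreFrobenioid.IsDivIdentity F₂ (Ψ.functor.map α)) :
    (∀ (A : C₁), ¬ PreFrobenioid.IsGroupLikeObj F₁ A → ∀ α : A ⟶ A, PreFrobenioid.IsDivIdentity F₁ α →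
        PreFrobenioid.IsPrimeFrobenius F₁ α → PreFrobenioid.IsDivIdentity F₂ (Ψ.functor.map α)) ∧
    (∀ (A : C₁), ¬ PreFrobenioid.IsGroupLikeObj F₁ A → PreFrobenioid.IsDivFrobeniusTrivial F₁ A →
        PreFrobenioid.IsDivFrobeniusTrivial F₂ (Ψ.functor.obj A)) ∧
    ∀ (A : C₁), ¬ PreFrobenioid.IsGroupLikeObj F₁ A → PreFrobenioid.IsUniversallyDivFrobeniusTrivial F₁ A →
        PreFrobenioid.IsUniversallyDivFrobeniusTrivial F₂ (Ψ.functor.obj A) := by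
  -- the Div-identity hypothesis at EVERY object: automatic at group-like ones
  have hall : ∀ (A : C₁) (α : A ⟶ A), PreFrobenioid.IsDivIdentity F₁ α →
      PreFrobenioid.IsDivIdentity F₂ (Ψ.functor.map α) := by
    intro A α hα
    by_cases hA : PreFrobenioid.IsGroupLikeObj F₁ A
    · exact PreFrobenioid.isDivIdentity_map_of_isGroupLikeObj Ψ.functor
        (fun A h => S.isGroupLikeObj_map h) hA α
    · exact hdivid A hA α hα
  refine ⟨fun A hA α hα _ => hdivid A hA α hα, fun A _ hA => ?_, fun A _ hA => ?_⟩
  · exact PreFrobenioid.isDivFrobeniusTrivial_map Ψ S.frobeniusType_map S.degFr_map (hall A) hA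
  · exact PreFrobenioid.isUniversallyDivFrobeniusTrivial_map Ψ S.isFrobenioid₂.isPreFrobenioid
      S.frobeniusType_map S.degFr_map S.pullback_inv (fun A' _ _ => hall A') hA

/-- **Row T42-L02 from row L11 BY NAME**: given the slot `PreservesDivIdentity` (row L11: in the setting,
with `Φ_i` non-dilating and primary pre-steps preserved both ways, `Ψ` preserves Div-identity
endomorphisms of non-group-like objects), the three clauses of `PreservesDivFrobTrivial` hold in every
such setting. [cite: MochizukiFrdI2008, Thm. 4.2 (i) p.78] -/
theorem preservesDivFrobTrivial_of_preservesDivIdentity (h11 : PreservesDivIdentity.{w, v, v', u, u'})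
    (S : Setting F₁ F₂ Ψ) (hnd₁ : IsNonDilatingOn Φ₁) (hnd₂ : IsNonDilatingOn Φ₂)
    (hprim : ∀ ⦃X Y : C₁⦄ (φ : X ⟶ Y), PreFrobenioid.IsPrimaryPreStep F₁ φ →
      PreFrobenioid.IsPrimaryPreStep F₂ (Ψ.functor.map φ))
    (hprim' : ∀ ⦃X Y : C₂⦄ (φ : X ⟶ Y), PreFrobenioid.IsPrimaryPreStep F₂ φ →
      PreFrobenioid.IsPrimaryPreStep F₁ (Ψ.inverse.map φ)) :
    (∀ (A : C₁), ¬ PreFrobenioid.IsGroupLikeObj F₁ A → ∀ α : A ⟶ A, PreFrobenioid.IsDivIdentity F₁ α →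
        PreFrobenioid.IsPrimeFrobenius F₁ α → PreFrobenioid.IsDivIdentity F₂ (Ψ.functor.map α)) ∧
    (∀ (A : C₁), ¬ PreFrobenioid.IsGroupLikeObj F₁ A → PreFrobenioid.IsDivFrobeniusTrivial F₁ A →
        PreFrobenioid.IsDivFrobeniusTrivial F₂ (Ψ.functor.obj A)) ∧
    ∀ (A : C₁), ¬ PreFrobenioid.IsGroupLikeObj F₁ A → PreFrobenioid.IsUniversallyDivFrobeniusTrivial F₁ A →
        PreFrobenioid.IsUniversallyDivFrobeniusTrivial F₂ (Ψ.functor.obj A) :=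
  preservesDivFrobTrivial_of_isDivIdentity_map S (h11 F₁ F₂ Ψ S hnd₁ hnd₂ hprim hprim')

/-! ### Clause (a) over bases of FSM-type (Prop. 1.14 (v) route) -/

/-- **Row T42-L02, clause (a), over bases of FSM-type with `Φ₂` non-dilating** (the printed route:
Prop. 1.14 (v), in the cell's kernel form `FrdI.isDivIdentity_isPrimeFrobenius_map`, seat abc-iut-L1-t13):
`Ψ` carries a Div-identity prime-Frobenius endomorphism of a non-group-like object to a Div-identity
prime-Frobenius endomorphism. [cite: MochizukiFrdI2008, Thm. 4.2 (i) p.78] -/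
theorem isDivIdentity_isPrimeFrobenius_map_of_isOfFSMType (S : Setting F₁ F₂ Ψ) (hD₁ : IsOfFSMType D₁)
    (hD₂ : IsOfFSMType D₂) (hnd₂ : IsNonDilatingOn Φ₂) {A : C₁} (hA : ¬ PreFrobenioid.IsGroupLikeObj F₁ A)
    {α : A ⟶ A} (hdi : PreFrobenioid.IsDivIdentity F₁ α) (hpf : PreFrobenioid.IsPrimeFrobenius F₁ α) :
    PreFrobenioid.IsDivIdentity F₂ (Ψ.functor.map α) ∧ PreFrobenioid.IsPrimeFrobenius F₂ (Ψ.functor.map α) :=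
  FrdI.isDivIdentity_isPrimeFrobenius_map S.isFrobenioid₁ S.isFrobenioid₂ S.isotropic₁ S.isotropic₂ hD₁ hD₂
    hnd₂ Ψ hA hdi hpf

end FrdI.T42

end Literature.AlgebraicGeometry.Frobenioids
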